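import Summits.QuantumFields.BalabanUV.Beta.SpineRecursiveWSockets
import Summits.QuantumFields.BalabanUV.Beta.SpineRecursiveT2Step

/-!
# `BalabanUV.Beta.SpineRecursiveT2All` — binder row D1, (L4) piece (W-IND): **THE SECOND-ORDER LETTER LAW AT EVERY LEVEL BY INDUCTION, AND hR FOR
# THE W-INSTANTIATED RECURSIVE WALL LITERAL FROM THE LETTERS** — (hT2-rem) ∀ j from the level-`0` letter, the border letter at every level, the mixed
# letter, the split identities, localisations, and the two second-order locks; then the (W-ASM) root `…_JsRecWAtOf_remRM`
# (β sub-cell, row BETA-an2 = BINDER-OWNERS row D1 OWNER, lineage an2 gen 18; memo `SKELETON-D1-L4.v2` §3 (W-IND))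

HONEST FRAMING (cell charter, verbatim): «discharging BetaPertH makes Balaban's UV stability UNCONDITIONAL — a real
constructive-QFT result; it is NOT the continuum limit and NOT the Clay problem.»  DERIVED cell leaf (wiring, [folklore]); no statement of
Bałaban's papers, no `[cite:]`, no `def`, no `Prop` fact.  EVERY LETTER IS A HYPOTHESIS (none is in the tree at the time of writing); the file
instantiates no binder of the wall by itself.  NOT D1, NOT `BetaPertH`, NOT continuum, NOT Clay.

## What is here (`d + 1 = 4`, odd `Lc`, centred root, pin `(cE, cVH) = (Lc⁴, −Lc⁸/2)`)

* **`T2RecAt_bref_all_of_letters`**: `∀ j α κ u κ′ u′`, (hT2-rem)(j) with second symbols `h j α` and remainders `R2 j α`, BY INDUCTION ON `j` from: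
  (h0) the level-`0` letter in (hT2-rem) form [(W-LET-S₂)₀: an3/leaf-09 Wilson + an1 border]; (hM2) the mixed letter ∀ j with remainder `RM`
  [(W-LET-M₂): an1]; (hsplit)/(hDg)/(hX2L)/(hΔL) the split identities and localisations ∀ j [(W-SPLIT-DECAY), mechanical]; (hBfm/hBmf/hBmm)+(hRBff)
  the BORDER LETTER at every level `j+1` with symbol `h (j+1) α` and remainder `RB (j+1) α` [(W-0B): an1]; (hlock2) `cE₂·wV4·wVH = (Lc⁴·wE)²`
  [(W-L-2)]; (hB0) the border table vanishes on the field block; and (hR2succ) THE REMAINDER RECURSION — `R2 (j+1)` IS the displayed remainder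
  of the level step (`SpineRecursiveT2Step.T2RecAt_succ_bref_of_laws` with `Rm := ½•conjV … + ½•(Δ + Δᵀ)` of `SpineRecursiveWSockets.WrecAt_bref_of_T2RM`),
  i.e. the user DEFINES `R2` by this recursion from `R2 0` (the level-`0` letter's remainder).  Step = `WrecAt_bref_of_T2RM` then `T2RecAt_succ_bref_of_laws`.
* **`axisReflectionCovariant_flipK_TbalOf_JsRecWAtOf_of_letters`**: the same hypotheses + (hBt)/(hmixt) block covariance of the binder tables +
  (hΔ0) tadpole-nullity of the split residuals ⇒ `∀ j, AxisReflectionCovariant (flipK (TbalOf Lc (JsRecWAtOf …) j))` — **hR FOR THE RECURSIVE WALL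
  LITERAL v2.26 WITH ITS W-LITERAL ⟸ EXACTLY THE LETTERS + MECHANICAL LEAVES + LOCKS** (`…_JsRecWAtOf_remRM` ∘ the induction).
Provenance: β sub-cell, unit beta-an2 gen 18, 2026-08-20 (v1); no existing file touched.
-/

open Finset
open scoped BigOperators
open Literature.MathematicalPhysics.QuantumFieldTheory
open Literature.MathematicalPhysics.QuantumFieldTheory.Balaban1983to89
open Literature.MathematicalPhysics.QuantumFieldTheory.Balaban1983to89.Beta
open ExpKernelCalculus (MKer Decays BiLoc comp tadpole VertexFamily VertexFamily₂ shiftK)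
open AffineAveraging (box toSite)
open AveragingContoursRooted (ctr ctrOff ctrOff_mem_box)
open PolarizationSign (reflSign AxisReflectionCovariant)
open KernelReflection (refK refK_apply)
open ResolventReflection (bref Φ)
open OneStepResolventKernel (Fib LocStencil JetData wsum)
open OneStepKernelFamily (KInvStep colH vertexOfK TbalOf flipK)
open BalabanStepJetsSucc (wE wVH)
open BalabanCompositeJets (LocStencil₂)
open BalabanStepW2 (M2Of)
open SecondOrderResponse (dM W2OfK W2SymOfK LocStencilFM)
open Summit.QuantumFields.BalabanUV.Beta.TameKernelCalculus
open Summit.QuantumFields.BalabanUV.Beta.ChartConjugation (conjV conjW loc_conjV)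
open Summit.QuantumFields.BalabanUV.Beta.ChartConjugationRelative (RelInv)
open Summit.QuantumFields.BalabanUV.Beta.AxialDressingRooted (coDressKBmAt axEc spr_axEc one_le_of_neZero refK_coDressKBmAt_KInvStep)
open Summit.QuantumFields.BalabanUV.Beta.BorderedHessian (diagK diagK_apply ctGen comp_axEc_diagK_comm bhKStepAt stepScale spr_bhKStepAt
  relInv_coDressKBmAt_KInvStep_bhKStepAt)
open Summit.QuantumFields.BalabanUV.Beta.WardLocusRecursive (SrecAt SrecAt_zero)
open Summit.QuantumFields.BalabanUV.Beta.VertexReflectionContact (smul_diagK)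
open Summit.QuantumFields.BalabanUV.Beta.SecondOrderTransport (W2SymOfK_bref_sharp)
open Summit.QuantumFields.BalabanUV.Beta.SecondOrderSymContact (W2SymOfK_sharp_split_of tadpole_conjV_rel_eq_zero tadpole_rem_eq_zero loc_rem)
open Summit.QuantumFields.BalabanUV.Beta.LagrangeFoldSrec (vertexOfK_S0NAt_split vertexOfK_SrecAt_succ_split)
open BalabanStepW2 (wV4 wB2)
open BalabanStepJetsSucc (mmRead)
open Summit.QuantumFields.BalabanUV.Beta.WardLocusCubic (mmSym)

noncomputable section

namespace Summit.QuantumFields.BalabanUV.Beta.SpineRooted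

section Wall

variable {Lc : ℕ} [NeZero Lc]

/-- [folklore] **THE SECOND-ORDER LETTER LAW (hT2-rem) AT EVERY LEVEL, BY INDUCTION** (see the module docstring). -/
theorem T2RecAt_bref_all_of_letters (hLc : Odd Lc) (cΛ cE₂ cB : ℝ) (T : Fin 4 → Fin 4 → Fin 4 → Fin 4 → ℝ)
    {vh₂S : Fin 4 → (Fin 4 → ℤ) → Fin 4 → (Fin 4 → ℤ) → MKer 4 (Fib 3)} (hB : ∃ C δ : ℝ, 0 < δ ∧ LocStencil₂ vh₂S C δ)
    (hB0 : ∀ κ u κ' u' (x z : Fin 4 → ℤ) (β β' : Fin 4), vh₂S κ u κ' u' x z (Sum.inl β) (Sum.inl β') = 0)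
    {mixFF : Fin 4 → (Fin 4 → ℤ) → Fin 4 → (Fin 4 → ℤ) → MKer 4 (Fib 3)} (hmix : ∃ C δ : ℝ, 0 < δ ∧ LocStencilFM Lc mixFF C δ)
    (γ : ℕ → ℝ) (hγ : ∀ j, γ j = -((Lc : ℝ) ^ 8 / 2) * wVH 3 Lc j / (stepScale 3 Lc j * (Lc : ℝ) ^ 4))
    (hlock2 : ∀ j, cE₂ * wV4 3 Lc (j + 1) * wVH 3 Lc (j + 1) = ((Lc : ℝ) ^ 4 * wE 3 Lc (j + 1)) ^ 2)
    (h : ℕ → Fin 4 → Fin 4 → (Fin 4 → ℤ) → Fin 4 → (Fin 4 → ℤ) → (Fin 4 → ℤ) → Fib 3 → ℝ)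
    (R2 : ℕ → Fin 4 → Fin 4 → (Fin 4 → ℤ) → Fin 4 → (Fin 4 → ℤ) → MKer 4 (Fib 3))
    (RM : ℕ → Fin 4 → Fin 4 → (Fin 4 → ℤ) → Fin 4 → (Fin 4 → ℤ) → MKer 4 (Fib 3))
    (h0 : ∀ (α κ : Fin 4) (u : Fin 4 → ℤ) (κ' : Fin 4) (u' : Fin 4 → ℤ),
      T2RecAt 3 Lc (toSite (ctrOff 4 Lc)) ((Lc : ℝ) ^ 4) (-((Lc : ℝ) ^ 8 / 2)) cΛ cE₂ cB T vh₂S mixFF 0 κ (bref α κ u) κ' (bref α κ' u') =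
        (reflSign α κ * reflSign α κ') • refK (Φ Lc α)
          (T2RecAt 3 Lc (toSite (ctrOff 4 Lc)) ((Lc : ℝ) ^ 4) (-((Lc : ℝ) ^ 8 / 2)) cΛ cE₂ cB T vh₂S mixFF 0 κ u κ' u' +
            conjW (bhKStepAt 3 (toSite (ctrOff 4 Lc)) Lc 0)
              (SpureRecAt 3 Lc (toSite (ctrOff 4 Lc)) ((Lc : ℝ) ^ 4) (-((Lc : ℝ) ^ 8 / 2)) cΛ 0 κ u)
              (SpureRecAt 3 Lc (toSite (ctrOff 4 Lc)) ((Lc : ℝ) ^ 4) (-((Lc : ℝ) ^ 8 / 2)) cΛ 0 κ' u')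
              (diagK fun p c => γ 0 * ctGen 3 α Lc κ u p c) (diagK fun p c => γ 0 * ctGen 3 α Lc κ' u' p c) (diagK (h 0 α κ u κ' u')) +
            R2 0 α κ u κ' u'))
    (hM2 : ∀ (j : ℕ) (α κ : Fin 4) (u : Fin 4 → ℤ) (ρ : Fin 4) (w : Fin 4 → ℤ),
      M2Of 3 Lc mixFF j κ (bref α κ u) ρ (bref α ρ w) =
        (reflSign α κ * reflSign α ρ) • refK (Φ Lc α)
          (M2Of 3 Lc mixFF j κ u ρ w + conjV (M1At 3 Lc (toSite (ctrOff 4 Lc)) cΛ j ρ w) (diagK fun p c => γ j * ctGen 3 α Lc κ u p c) +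
            RM j α κ u ρ w))
    (X2s : ℕ → Fin 4 → Fin 4 → (Fin 4 → ℤ) → Fin 4 → (Fin 4 → ℤ) → (Fin 4 → ℤ) → Fib 3 → ℝ)
    (Δ : ℕ → Fin 4 → Fin 4 → (Fin 4 → ℤ) → Fin 4 → (Fin 4 → ℤ) → MKer 4 (Fib 3))
    (hsplit : ∀ (j : ℕ) (α μ : Fin 4) (y : Fin 4 → ℤ) (ν : Fin 4) (y' : Fin 4 → ℤ),
      W2OfK (coDressKBmAt (toSite (ctrOff 4 Lc)) Lc (KInvStep (d := 3) Lc j)) Lc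
          (fun κ u => SpureRecAt 3 Lc (toSite (ctrOff 4 Lc)) ((Lc : ℝ) ^ 4) (-((Lc : ℝ) ^ 8 / 2)) cΛ j κ u +
            conjV (bhKStepAt 3 (toSite (ctrOff 4 Lc)) Lc j) (diagK fun p c => γ j * ctGen 3 α Lc κ u p c))
          (M1At 3 Lc (toSite (ctrOff 4 Lc)) cΛ j)
          (fun κ u κ' u' => T2RecAt 3 Lc (toSite (ctrOff 4 Lc)) ((Lc : ℝ) ^ 4) (-((Lc : ℝ) ^ 8 / 2)) cΛ cE₂ cB T vh₂S mixFF j κ u κ' u' +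
            conjW (bhKStepAt 3 (toSite (ctrOff 4 Lc)) Lc j)
              (SpureRecAt 3 Lc (toSite (ctrOff 4 Lc)) ((Lc : ℝ) ^ 4) (-((Lc : ℝ) ^ 8 / 2)) cΛ j κ u)
              (SpureRecAt 3 Lc (toSite (ctrOff 4 Lc)) ((Lc : ℝ) ^ 4) (-((Lc : ℝ) ^ 8 / 2)) cΛ j κ' u')
              (diagK fun p c => γ j * ctGen 3 α Lc κ u p c) (diagK fun p c => γ j * ctGen 3 α Lc κ' u' p c) (diagK (h j α κ u κ' u')) +
            R2 j α κ u κ' u')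
          (fun κ u ρ w => M2Of 3 Lc mixFF j κ u ρ w + conjV (M1At 3 Lc (toSite (ctrOff 4 Lc)) cΛ j ρ w) (diagK fun p c => γ j * ctGen 3 α Lc κ u p c) +
            RM j α κ u ρ w)
          μ y ν y' =
        W2OfK (coDressKBmAt (toSite (ctrOff 4 Lc)) Lc (KInvStep (d := 3) Lc j)) Lc
            (SpureRecAt 3 Lc (toSite (ctrOff 4 Lc)) ((Lc : ℝ) ^ 4) (-((Lc : ℝ) ^ 8 / 2)) cΛ j) (M1At 3 Lc (toSite (ctrOff 4 Lc)) cΛ j)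
            (T2RecAt 3 Lc (toSite (ctrOff 4 Lc)) ((Lc : ℝ) ^ 4) (-((Lc : ℝ) ^ 8 / 2)) cΛ cE₂ cB T vh₂S mixFF j) (M2Of 3 Lc mixFF j) μ y ν y' +
          conjW (bhKStepAt 3 (toSite (ctrOff 4 Lc)) Lc j)
            (dM (coDressKBmAt (toSite (ctrOff 4 Lc)) Lc (KInvStep (d := 3) Lc j)) Lc
              (SpureRecAt 3 Lc (toSite (ctrOff 4 Lc)) ((Lc : ℝ) ^ 4) (-((Lc : ℝ) ^ 8 / 2)) cΛ j) (M1At 3 Lc (toSite (ctrOff 4 Lc)) cΛ j) μ y)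
            (dM (coDressKBmAt (toSite (ctrOff 4 Lc)) Lc (KInvStep (d := 3) Lc j)) Lc
              (SpureRecAt 3 Lc (toSite (ctrOff 4 Lc)) ((Lc : ℝ) ^ 4) (-((Lc : ℝ) ^ 8 / 2)) cΛ j) (M1At 3 Lc (toSite (ctrOff 4 Lc)) cΛ j) ν y')
            (diagK fun p c => ∑ κ, ∑' u, colH (coDressKBmAt (toSite (ctrOff 4 Lc)) Lc (KInvStep (d := 3) Lc j)) Lc μ y κ u * (γ j * ctGen 3 α Lc κ u p c))
            (diagK fun p c => ∑ κ, ∑' u, colH (coDressKBmAt (toSite (ctrOff 4 Lc)) Lc (KInvStep (d := 3) Lc j)) Lc ν y' κ u * (γ j * ctGen 3 α Lc κ u p c))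
            (diagK (X2s j α μ y ν y')) +
          Δ j α μ y ν y')
    (hDg : ∀ (j : ℕ) (α ν : Fin 4) (y' : Fin 4 → ℤ),
      Loc (dM (coDressKBmAt (toSite (ctrOff 4 Lc)) Lc (KInvStep (d := 3) Lc j)) Lc
        (fun κ u => SpureRecAt 3 Lc (toSite (ctrOff 4 Lc)) ((Lc : ℝ) ^ 4) (-((Lc : ℝ) ^ 8 / 2)) cΛ j κ u +
          conjV (bhKStepAt 3 (toSite (ctrOff 4 Lc)) Lc j) (diagK fun p c => γ j * ctGen 3 α Lc κ u p c))
        (M1At 3 Lc (toSite (ctrOff 4 Lc)) cΛ j) ν y'))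
    (hX2L : ∀ j α μ y ν y', Loc (diagK (X2s j α μ y ν y'))) (hΔL : ∀ j α μ y ν y', Loc (Δ j α μ y ν y'))
    (RB : ℕ → Fin 4 → Fin 4 → (Fin 4 → ℤ) → Fin 4 → (Fin 4 → ℤ) → MKer 4 (Fib 3))
    (hRBff : ∀ j α κ u κ' u' (x z : Fin 4 → ℤ) (β β' : Fin 4), RB j α κ u κ' u' x z (Sum.inl β) (Sum.inl β') = 0)
    (hBfm : ∀ (j : ℕ) (α : Fin 4) κ u κ' u' (x z : Fin 4 → ℤ) (β m : Fin 4),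
      ((cB * wB2 3 Lc (j + 1)) • vh₂S κ (bref α κ u) κ' (bref α κ' u')) x z (Sum.inl β) (Sum.inr m) =
        ((reflSign α κ * reflSign α κ') • refK (Φ Lc α) ((cB * wB2 3 Lc (j + 1)) • vh₂S κ u κ' u' +
          conjW (bhKStepAt 3 (toSite (ctrOff 4 Lc)) Lc (j + 1))
            (SpureRecAt 3 Lc (toSite (ctrOff 4 Lc)) ((Lc : ℝ) ^ 4) (-((Lc : ℝ) ^ 8 / 2)) cΛ (j + 1) κ u)
            (SpureRecAt 3 Lc (toSite (ctrOff 4 Lc)) ((Lc : ℝ) ^ 4) (-((Lc : ℝ) ^ 8 / 2)) cΛ (j + 1) κ' u')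
            (diagK fun p c => γ (j + 1) * ctGen 3 α Lc κ u p c) (diagK fun p c => γ (j + 1) * ctGen 3 α Lc κ' u' p c) (diagK (h (j + 1) α κ u κ' u')) +
          RB (j + 1) α κ u κ' u')) x z (Sum.inl β) (Sum.inr m))
    (hBmf : ∀ (j : ℕ) (α : Fin 4) κ u κ' u' (x z : Fin 4 → ℤ) (m β : Fin 4),
      ((cB * wB2 3 Lc (j + 1)) • vh₂S κ (bref α κ u) κ' (bref α κ' u')) x z (Sum.inr m) (Sum.inl β) =
        ((reflSign α κ * reflSign α κ') • refK (Φ Lc α) ((cB * wB2 3 Lc (j + 1)) • vh₂S κ u κ' u' +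
          conjW (bhKStepAt 3 (toSite (ctrOff 4 Lc)) Lc (j + 1))
            (SpureRecAt 3 Lc (toSite (ctrOff 4 Lc)) ((Lc : ℝ) ^ 4) (-((Lc : ℝ) ^ 8 / 2)) cΛ (j + 1) κ u)
            (SpureRecAt 3 Lc (toSite (ctrOff 4 Lc)) ((Lc : ℝ) ^ 4) (-((Lc : ℝ) ^ 8 / 2)) cΛ (j + 1) κ' u')
            (diagK fun p c => γ (j + 1) * ctGen 3 α Lc κ u p c) (diagK fun p c => γ (j + 1) * ctGen 3 α Lc κ' u' p c) (diagK (h (j + 1) α κ u κ' u')) +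
          RB (j + 1) α κ u κ' u')) x z (Sum.inr m) (Sum.inl β))
    (hBmm : ∀ (j : ℕ) (α : Fin 4) κ u κ' u' (x z : Fin 4 → ℤ) (m m' : Fin 4),
      ((cB * wB2 3 Lc (j + 1)) • vh₂S κ (bref α κ u) κ' (bref α κ' u')) x z (Sum.inr m) (Sum.inr m') =
        ((reflSign α κ * reflSign α κ') • refK (Φ Lc α) ((cB * wB2 3 Lc (j + 1)) • vh₂S κ u κ' u' +
          conjW (bhKStepAt 3 (toSite (ctrOff 4 Lc)) Lc (j + 1))
            (SpureRecAt 3 Lc (toSite (ctrOff 4 Lc)) ((Lc : ℝ) ^ 4) (-((Lc : ℝ) ^ 8 / 2)) cΛ (j + 1) κ u)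
            (SpureRecAt 3 Lc (toSite (ctrOff 4 Lc)) ((Lc : ℝ) ^ 4) (-((Lc : ℝ) ^ 8 / 2)) cΛ (j + 1) κ' u')
            (diagK fun p c => γ (j + 1) * ctGen 3 α Lc κ u p c) (diagK fun p c => γ (j + 1) * ctGen 3 α Lc κ' u' p c) (diagK (h (j + 1) α κ u κ' u')) +
          RB (j + 1) α κ u κ' u')) x z (Sum.inr m) (Sum.inr m'))
    (hR2succ : ∀ (j : ℕ) (α κ : Fin 4) (u : Fin 4 → ℤ) (κ' : Fin 4) (u' : Fin 4 → ℤ),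
      R2 (j + 1) α κ u κ' u' =
        -((cE₂ * wV4 3 Lc (j + 1)) • mmRead Lc
            (comp (comp (coDressKBmAt (toSite (ctrOff 4 Lc)) Lc (KInvStep (d := 3) Lc j))
              ((1 / 2 : ℝ) • conjV (bhKStepAt 3 (toSite (ctrOff 4 Lc)) Lc j) (diagK fun p a => X2s j α κ' u' κ u p a - X2s j α κ u κ' u' p a) +
                (1 / 2 : ℝ) • (Δ j α κ u κ' u' + Δ j α κ' u' κ u)))
              (coDressKBmAt (toSite (ctrOff 4 Lc)) Lc (KInvStep (d := 3) Lc j)))) +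
          RB (j + 1) α κ u κ' u' +
          conjV (mmRead Lc (coDressKBmAt (toSite (ctrOff 4 Lc)) Lc (KInvStep (d := 3) Lc j)))
            (diagK fun p c => cE₂ * wV4 3 Lc (j + 1) * mmSym Lc (X2s j α κ u κ' u') p c - wVH 3 Lc (j + 1) * h (j + 1) α κ u κ' u' p c))
    :
    ∀ (j : ℕ) (α κ : Fin 4) (u : Fin 4 → ℤ) (κ' : Fin 4) (u' : Fin 4 → ℤ),
      T2RecAt 3 Lc (toSite (ctrOff 4 Lc)) ((Lc : ℝ) ^ 4) (-((Lc : ℝ) ^ 8 / 2)) cΛ cE₂ cB T vh₂S mixFF j κ (bref α κ u) κ' (bref α κ' u') =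
        (reflSign α κ * reflSign α κ') • refK (Φ Lc α)
          (T2RecAt 3 Lc (toSite (ctrOff 4 Lc)) ((Lc : ℝ) ^ 4) (-((Lc : ℝ) ^ 8 / 2)) cΛ cE₂ cB T vh₂S mixFF j κ u κ' u' +
            conjW (bhKStepAt 3 (toSite (ctrOff 4 Lc)) Lc j)
              (SpureRecAt 3 Lc (toSite (ctrOff 4 Lc)) ((Lc : ℝ) ^ 4) (-((Lc : ℝ) ^ 8 / 2)) cΛ j κ u)
              (SpureRecAt 3 Lc (toSite (ctrOff 4 Lc)) ((Lc : ℝ) ^ 4) (-((Lc : ℝ) ^ 8 / 2)) cΛ j κ' u')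
              (diagK fun p c => γ j * ctGen 3 α Lc κ u p c) (diagK fun p c => γ j * ctGen 3 α Lc κ' u' p c) (diagK (h j α κ u κ' u')) +
            R2 j α κ u κ' u') := by
  have hL1 : 1 ≤ Lc := hLc.pos
  intro j
  induction j with
  | zero => exact h0
  | succ j ih =>
    intro α κ u κ' u'
    have hW := WrecAt_bref_of_T2RM hLc cΛ cE₂ cB T vh₂S mixFF γ hγ j α (h j α) (R2 j α) (RM j α) (ih α) (hM2 j α) (X2s j α) (Δ j α)
      (hsplit j α) (hDg j α)
    rw [hR2succ j α κ u κ' u']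
    exact T2RecAt_succ_bref_of_laws hLc cΛ cE₂ cB T hB hB0 hmix γ hγ hlock2 j α (X2s j α) _ (hX2L j α)
      (loc_WRem (j := j) hL1 (hX2L j α) (hΔL j α)) hW (h (j + 1) α) (RB (j + 1) α) (hRBff (j + 1) α) (hBfm j α) (hBmf j α) (hBmm j α)
      κ u κ' u'

/-- [folklore] **hR FOR THE RECURSIVE WALL LITERAL v2.26 WITH ITS W-LITERAL ⟸ EXACTLY THE LETTERS + MECHANICAL LEAVES + LOCKS**
(`…_JsRecWAtOf_remRM` fed by `T2RecAt_bref_all_of_letters`). -/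
theorem axisReflectionCovariant_flipK_TbalOf_JsRecWAtOf_of_letters (hLc : Odd Lc) (cΛ cE₂ cB : ℝ) (T : Fin 4 → Fin 4 → Fin 4 → Fin 4 → ℝ)
    {vh₂S : Fin 4 → (Fin 4 → ℤ) → Fin 4 → (Fin 4 → ℤ) → MKer 4 (Fib 3)} (hB : ∃ C δ : ℝ, 0 < δ ∧ LocStencil₂ vh₂S C δ)
    (hB0 : ∀ κ u κ' u' (x z : Fin 4 → ℤ) (β β' : Fin 4), vh₂S κ u κ' u' x z (Sum.inl β) (Sum.inl β') = 0)
    {mixFF : Fin 4 → (Fin 4 → ℤ) → Fin 4 → (Fin 4 → ℤ) → MKer 4 (Fib 3)} (hmix : ∃ C δ : ℝ, 0 < δ ∧ LocStencilFM Lc mixFF C δ)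
    (γ : ℕ → ℝ) (hγ : ∀ j, γ j = -((Lc : ℝ) ^ 8 / 2) * wVH 3 Lc j / (stepScale 3 Lc j * (Lc : ℝ) ^ 4))
    (hlock2 : ∀ j, cE₂ * wV4 3 Lc (j + 1) * wVH 3 Lc (j + 1) = ((Lc : ℝ) ^ 4 * wE 3 Lc (j + 1)) ^ 2)
    (h : ℕ → Fin 4 → Fin 4 → (Fin 4 → ℤ) → Fin 4 → (Fin 4 → ℤ) → (Fin 4 → ℤ) → Fib 3 → ℝ)
    (R2 : ℕ → Fin 4 → Fin 4 → (Fin 4 → ℤ) → Fin 4 → (Fin 4 → ℤ) → MKer 4 (Fib 3))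
    (RM : ℕ → Fin 4 → Fin 4 → (Fin 4 → ℤ) → Fin 4 → (Fin 4 → ℤ) → MKer 4 (Fib 3))
    (h0 : ∀ (α κ : Fin 4) (u : Fin 4 → ℤ) (κ' : Fin 4) (u' : Fin 4 → ℤ),
      T2RecAt 3 Lc (toSite (ctrOff 4 Lc)) ((Lc : ℝ) ^ 4) (-((Lc : ℝ) ^ 8 / 2)) cΛ cE₂ cB T vh₂S mixFF 0 κ (bref α κ u) κ' (bref α κ' u') =
        (reflSign α κ * reflSign α κ') • refK (Φ Lc α)
          (T2RecAt 3 Lc (toSite (ctrOff 4 Lc)) ((Lc : ℝ) ^ 4) (-((Lc : ℝ) ^ 8 / 2)) cΛ cE₂ cB T vh₂S mixFF 0 κ u κ' u' +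
            conjW (bhKStepAt 3 (toSite (ctrOff 4 Lc)) Lc 0)
              (SpureRecAt 3 Lc (toSite (ctrOff 4 Lc)) ((Lc : ℝ) ^ 4) (-((Lc : ℝ) ^ 8 / 2)) cΛ 0 κ u)
              (SpureRecAt 3 Lc (toSite (ctrOff 4 Lc)) ((Lc : ℝ) ^ 4) (-((Lc : ℝ) ^ 8 / 2)) cΛ 0 κ' u')
              (diagK fun p c => γ 0 * ctGen 3 α Lc κ u p c) (diagK fun p c => γ 0 * ctGen 3 α Lc κ' u' p c) (diagK (h 0 α κ u κ' u')) +
            R2 0 α κ u κ' u'))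
    (hM2 : ∀ (j : ℕ) (α κ : Fin 4) (u : Fin 4 → ℤ) (ρ : Fin 4) (w : Fin 4 → ℤ),
      M2Of 3 Lc mixFF j κ (bref α κ u) ρ (bref α ρ w) =
        (reflSign α κ * reflSign α ρ) • refK (Φ Lc α)
          (M2Of 3 Lc mixFF j κ u ρ w + conjV (M1At 3 Lc (toSite (ctrOff 4 Lc)) cΛ j ρ w) (diagK fun p c => γ j * ctGen 3 α Lc κ u p c) +
            RM j α κ u ρ w))
    (X2s : ℕ → Fin 4 → Fin 4 → (Fin 4 → ℤ) → Fin 4 → (Fin 4 → ℤ) → (Fin 4 → ℤ) → Fib 3 → ℝ)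
    (Δ : ℕ → Fin 4 → Fin 4 → (Fin 4 → ℤ) → Fin 4 → (Fin 4 → ℤ) → MKer 4 (Fib 3))
    (hsplit : ∀ (j : ℕ) (α μ : Fin 4) (y : Fin 4 → ℤ) (ν : Fin 4) (y' : Fin 4 → ℤ),
      W2OfK (coDressKBmAt (toSite (ctrOff 4 Lc)) Lc (KInvStep (d := 3) Lc j)) Lc
          (fun κ u => SpureRecAt 3 Lc (toSite (ctrOff 4 Lc)) ((Lc : ℝ) ^ 4) (-((Lc : ℝ) ^ 8 / 2)) cΛ j κ u +
            conjV (bhKStepAt 3 (toSite (ctrOff 4 Lc)) Lc j) (diagK fun p c => γ j * ctGen 3 α Lc κ u p c))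
          (M1At 3 Lc (toSite (ctrOff 4 Lc)) cΛ j)
          (fun κ u κ' u' => T2RecAt 3 Lc (toSite (ctrOff 4 Lc)) ((Lc : ℝ) ^ 4) (-((Lc : ℝ) ^ 8 / 2)) cΛ cE₂ cB T vh₂S mixFF j κ u κ' u' +
            conjW (bhKStepAt 3 (toSite (ctrOff 4 Lc)) Lc j)
              (SpureRecAt 3 Lc (toSite (ctrOff 4 Lc)) ((Lc : ℝ) ^ 4) (-((Lc : ℝ) ^ 8 / 2)) cΛ j κ u)
              (SpureRecAt 3 Lc (toSite (ctrOff 4 Lc)) ((Lc : ℝ) ^ 4) (-((Lc : ℝ) ^ 8 / 2)) cΛ j κ' u')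
              (diagK fun p c => γ j * ctGen 3 α Lc κ u p c) (diagK fun p c => γ j * ctGen 3 α Lc κ' u' p c) (diagK (h j α κ u κ' u')) +
            R2 j α κ u κ' u')
          (fun κ u ρ w => M2Of 3 Lc mixFF j κ u ρ w + conjV (M1At 3 Lc (toSite (ctrOff 4 Lc)) cΛ j ρ w) (diagK fun p c => γ j * ctGen 3 α Lc κ u p c) +
            RM j α κ u ρ w)
          μ y ν y' =
        W2OfK (coDressKBmAt (toSite (ctrOff 4 Lc)) Lc (KInvStep (d := 3) Lc j)) Lc
            (SpureRecAt 3 Lc (toSite (ctrOff 4 Lc)) ((Lc : ℝ) ^ 4) (-((Lc : ℝ) ^ 8 / 2)) cΛ j) (M1At 3 Lc (toSite (ctrOff 4 Lc)) cΛ j)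
            (T2RecAt 3 Lc (toSite (ctrOff 4 Lc)) ((Lc : ℝ) ^ 4) (-((Lc : ℝ) ^ 8 / 2)) cΛ cE₂ cB T vh₂S mixFF j) (M2Of 3 Lc mixFF j) μ y ν y' +
          conjW (bhKStepAt 3 (toSite (ctrOff 4 Lc)) Lc j)
            (dM (coDressKBmAt (toSite (ctrOff 4 Lc)) Lc (KInvStep (d := 3) Lc j)) Lc
              (SpureRecAt 3 Lc (toSite (ctrOff 4 Lc)) ((Lc : ℝ) ^ 4) (-((Lc : ℝ) ^ 8 / 2)) cΛ j) (M1At 3 Lc (toSite (ctrOff 4 Lc)) cΛ j) μ y)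
            (dM (coDressKBmAt (toSite (ctrOff 4 Lc)) Lc (KInvStep (d := 3) Lc j)) Lc
              (SpureRecAt 3 Lc (toSite (ctrOff 4 Lc)) ((Lc : ℝ) ^ 4) (-((Lc : ℝ) ^ 8 / 2)) cΛ j) (M1At 3 Lc (toSite (ctrOff 4 Lc)) cΛ j) ν y')
            (diagK fun p c => ∑ κ, ∑' u, colH (coDressKBmAt (toSite (ctrOff 4 Lc)) Lc (KInvStep (d := 3) Lc j)) Lc μ y κ u * (γ j * ctGen 3 α Lc κ u p c))
            (diagK fun p c => ∑ κ, ∑' u, colH (coDressKBmAt (toSite (ctrOff 4 Lc)) Lc (KInvStep (d := 3) Lc j)) Lc ν y' κ u * (γ j * ctGen 3 α Lc κ u p c))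
            (diagK (X2s j α μ y ν y')) +
          Δ j α μ y ν y')
    (hDg : ∀ (j : ℕ) (α ν : Fin 4) (y' : Fin 4 → ℤ),
      Loc (dM (coDressKBmAt (toSite (ctrOff 4 Lc)) Lc (KInvStep (d := 3) Lc j)) Lc
        (fun κ u => SpureRecAt 3 Lc (toSite (ctrOff 4 Lc)) ((Lc : ℝ) ^ 4) (-((Lc : ℝ) ^ 8 / 2)) cΛ j κ u +
          conjV (bhKStepAt 3 (toSite (ctrOff 4 Lc)) Lc j) (diagK fun p c => γ j * ctGen 3 α Lc κ u p c))
        (M1At 3 Lc (toSite (ctrOff 4 Lc)) cΛ j) ν y'))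
    (hX2L : ∀ j α μ y ν y', Loc (diagK (X2s j α μ y ν y'))) (hΔL : ∀ j α μ y ν y', Loc (Δ j α μ y ν y'))
    (RB : ℕ → Fin 4 → Fin 4 → (Fin 4 → ℤ) → Fin 4 → (Fin 4 → ℤ) → MKer 4 (Fib 3))
    (hRBff : ∀ j α κ u κ' u' (x z : Fin 4 → ℤ) (β β' : Fin 4), RB j α κ u κ' u' x z (Sum.inl β) (Sum.inl β') = 0)
    (hBfm : ∀ (j : ℕ) (α : Fin 4) κ u κ' u' (x z : Fin 4 → ℤ) (β m : Fin 4),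
      ((cB * wB2 3 Lc (j + 1)) • vh₂S κ (bref α κ u) κ' (bref α κ' u')) x z (Sum.inl β) (Sum.inr m) =
        ((reflSign α κ * reflSign α κ') • refK (Φ Lc α) ((cB * wB2 3 Lc (j + 1)) • vh₂S κ u κ' u' +
          conjW (bhKStepAt 3 (toSite (ctrOff 4 Lc)) Lc (j + 1))
            (SpureRecAt 3 Lc (toSite (ctrOff 4 Lc)) ((Lc : ℝ) ^ 4) (-((Lc : ℝ) ^ 8 / 2)) cΛ (j + 1) κ u)
            (SpureRecAt 3 Lc (toSite (ctrOff 4 Lc)) ((Lc : ℝ) ^ 4) (-((Lc : ℝ) ^ 8 / 2)) cΛ (j + 1) κ' u')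
            (diagK fun p c => γ (j + 1) * ctGen 3 α Lc κ u p c) (diagK fun p c => γ (j + 1) * ctGen 3 α Lc κ' u' p c) (diagK (h (j + 1) α κ u κ' u')) +
          RB (j + 1) α κ u κ' u')) x z (Sum.inl β) (Sum.inr m))
    (hBmf : ∀ (j : ℕ) (α : Fin 4) κ u κ' u' (x z : Fin 4 → ℤ) (m β : Fin 4),
      ((cB * wB2 3 Lc (j + 1)) • vh₂S κ (bref α κ u) κ' (bref α κ' u')) x z (Sum.inr m) (Sum.inl β) =
        ((reflSign α κ * reflSign α κ') • refK (Φ Lc α) ((cB * wB2 3 Lc (j + 1)) • vh₂S κ u κ' u' +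
          conjW (bhKStepAt 3 (toSite (ctrOff 4 Lc)) Lc (j + 1))
            (SpureRecAt 3 Lc (toSite (ctrOff 4 Lc)) ((Lc : ℝ) ^ 4) (-((Lc : ℝ) ^ 8 / 2)) cΛ (j + 1) κ u)
            (SpureRecAt 3 Lc (toSite (ctrOff 4 Lc)) ((Lc : ℝ) ^ 4) (-((Lc : ℝ) ^ 8 / 2)) cΛ (j + 1) κ' u')
            (diagK fun p c => γ (j + 1) * ctGen 3 α Lc κ u p c) (diagK fun p c => γ (j + 1) * ctGen 3 α Lc κ' u' p c) (diagK (h (j + 1) α κ u κ' u')) +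
          RB (j + 1) α κ u κ' u')) x z (Sum.inr m) (Sum.inl β))
    (hBmm : ∀ (j : ℕ) (α : Fin 4) κ u κ' u' (x z : Fin 4 → ℤ) (m m' : Fin 4),
      ((cB * wB2 3 Lc (j + 1)) • vh₂S κ (bref α κ u) κ' (bref α κ' u')) x z (Sum.inr m) (Sum.inr m') =
        ((reflSign α κ * reflSign α κ') • refK (Φ Lc α) ((cB * wB2 3 Lc (j + 1)) • vh₂S κ u κ' u' +
          conjW (bhKStepAt 3 (toSite (ctrOff 4 Lc)) Lc (j + 1))
            (SpureRecAt 3 Lc (toSite (ctrOff 4 Lc)) ((Lc : ℝ) ^ 4) (-((Lc : ℝ) ^ 8 / 2)) cΛ (j + 1) κ u)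
            (SpureRecAt 3 Lc (toSite (ctrOff 4 Lc)) ((Lc : ℝ) ^ 4) (-((Lc : ℝ) ^ 8 / 2)) cΛ (j + 1) κ' u')
            (diagK fun p c => γ (j + 1) * ctGen 3 α Lc κ u p c) (diagK fun p c => γ (j + 1) * ctGen 3 α Lc κ' u' p c) (diagK (h (j + 1) α κ u κ' u')) +
          RB (j + 1) α κ u κ' u')) x z (Sum.inr m) (Sum.inr m'))
    (hR2succ : ∀ (j : ℕ) (α κ : Fin 4) (u : Fin 4 → ℤ) (κ' : Fin 4) (u' : Fin 4 → ℤ),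
      R2 (j + 1) α κ u κ' u' =
        -((cE₂ * wV4 3 Lc (j + 1)) • mmRead Lc
            (comp (comp (coDressKBmAt (toSite (ctrOff 4 Lc)) Lc (KInvStep (d := 3) Lc j))
              ((1 / 2 : ℝ) • conjV (bhKStepAt 3 (toSite (ctrOff 4 Lc)) Lc j) (diagK fun p a => X2s j α κ' u' κ u p a - X2s j α κ u κ' u' p a) +
                (1 / 2 : ℝ) • (Δ j α κ u κ' u' + Δ j α κ' u' κ u)))
              (coDressKBmAt (toSite (ctrOff 4 Lc)) Lc (KInvStep (d := 3) Lc j)))) +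
          RB (j + 1) α κ u κ' u' +
          conjV (mmRead Lc (coDressKBmAt (toSite (ctrOff 4 Lc)) Lc (KInvStep (d := 3) Lc j)))
            (diagK fun p c => cE₂ * wV4 3 Lc (j + 1) * mmSym Lc (X2s j α κ u κ' u') p c - wVH 3 Lc (j + 1) * h (j + 1) α κ u κ' u' p c))
    (hBt : ∀ (κ : Fin 4) (u : Fin 4 → ℤ) (κ' : Fin 4) (u' t : Fin 4 → ℤ),
      vh₂S κ (u + (Lc : ℤ) • t) κ' (u' + (Lc : ℤ) • t) = shiftK (-((Lc : ℤ) • t)) (vh₂S κ u κ' u'))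
    (hmixt : ∀ (κ : Fin 4) (u : Fin 4 → ℤ) (μ : Fin 4) (w t : Fin 4 → ℤ),
      mixFF κ (u + (Lc : ℤ) • t) μ (w + t) = shiftK (-((Lc : ℤ) • t)) (mixFF κ u μ w))
    (hΔ0 : ∀ j α μ y ν y', tadpole (coDressKBmAt (toSite (ctrOff 4 Lc)) Lc (KInvStep (d := 3) Lc j)) (Δ j α μ y ν y') = 0) :
    ∀ j : ℕ, AxisReflectionCovariant
      (flipK (TbalOf Lc (JsRecWAtOf (d := 3) hLc.pos (ctrOff_mem_box hLc.pos) ((Lc : ℝ) ^ 4) (-((Lc : ℝ) ^ 8 / 2)) cΛ cE₂ cB T hB hmix) j)) :=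
  axisReflectionCovariant_flipK_TbalOf_JsRecWAtOf_remRM hLc cΛ cE₂ cB T hB hmix hBt hmixt γ hγ h R2 RM
    (T2RecAt_bref_all_of_letters hLc cΛ cE₂ cB T hB hB0 hmix γ hγ hlock2 h R2 RM h0 hM2 X2s Δ hsplit hDg hX2L hΔL RB hRBff hBfm hBmf hBmm hR2succ)
    hM2 X2s Δ hsplit hDg hX2L hΔL hΔ0

end Wall

end Summit.QuantumFields.BalabanUV.Beta.SpineRooted

end
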